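import Summits.PneNP.PneNP.Theorems.ConvexRankGatesCaptureDefs
import Mathlib.GroupTheory.Commutator.Basic
import Mathlib.GroupTheory.OrderOfElement
import Mathlib.Algebra.Group.MinimalAxioms
import HarnessLib

/-!
# Route ConvexRankGates, crux `Capture` (stmt-PneNP-2659), line `csp-spine-meet-to-join`: the Baer trick

Stub 3b of the line (`stub_nonabelianCosetCapture`, open) asks for extended-monotone circuits computing COSET
gates over NONABELIAN groups. For groups of ODD order and nilpotency class `≤ 2` (central commutators) this is
ALREADY the abelian Stub 3a (landed, `stub_cosetMeetToJoinAbelian`), by R. Baer's trick (Baer 1938; used for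
coset CSPs by Lichter–Pago 2024, proof of Thm 6.2): with `half g := g ^ ((|G|+1)/2)` (the unique square root,
`|G|` odd) the operation `x ⋆ y := x y · half ⁅x,y⁆⁻¹` is an ABELIAN group law on `G` with the same unit and
inverses (`Baer.group`, `Baer.mul_comm`), and every left coset `c · H` of a subgroup `H ≤ G^r` is a coset
`c ⋆ H'` of the `⋆`-subgroup `H' = {δ · half ⁅c, δ⁆ : δ ∈ H}` (`Baer.twist`, coordinatewise). Hence every
COSET gate datum over such a group is an abelian COSET gate datum with the same size parameters
(`isAbelianCosetGate_of_odd_central`, registered sub-goal), and Stub 3a applies.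

Elementary group theory, kernel-checked; no circuits in this file. Lead prover-line-stmt-PneNP-2659-0,
2026-08-16. [folklore; cite: LichterPago2024 Thm 6.2]
-/

namespace Summit.PneNP.PneNP.Cruxes.Capture.CspSpineMeetToJoin

set_option linter.dupNamespace false -- `Summit.PneNP.PneNP.…`: summit = sub-problem (D-0017)

open Literature.Computability.Complexity
open scoped commutatorElement

/-! ## Commutator calculus under central commutators (class ≤ 2) -/

section ClassTwo

variable {G : Type*} [Group G]

/-- `x * y = ⁅x, y⁆ * (y * x)` (definition of the commutator). -/
theorem baer_mul_eq_comm_mul (x y : G) : x * y = ⁅x, y⁆ * (y * x) := by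
  rw [commutatorElement_def]; group

variable (hc : ∀ x y z : G, ⁅x, y⁆ * z = z * ⁅x, y⁆)
include hc

/-- Central commutators: `⁅x * y, z⁆ = ⁅x, z⁆ * ⁅y, z⁆`. -/
theorem baer_comm_mul_left (x y z : G) : ⁅x * y, z⁆ = ⁅x, z⁆ * ⁅y, z⁆ := by
  have h1 : ⁅x * y, z⁆ = x * ⁅y, z⁆ * x⁻¹ * ⁅x, z⁆ := by
    simp only [commutatorElement_def]; group
  rw [h1, ← hc y z x]
  have h2 : ⁅y, z⁆ * x * x⁻¹ * ⁅x, z⁆ = ⁅y, z⁆ * ⁅x, z⁆ := by group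
  rw [h2, hc y z ⁅x, z⁆]

/-- Central commutators: `⁅x, y * z⁆ = ⁅x, y⁆ * ⁅x, z⁆`. -/
theorem baer_comm_mul_right (x y z : G) : ⁅x, y * z⁆ = ⁅x, y⁆ * ⁅x, z⁆ := by
  have h1 : ⁅x, y * z⁆ = ⁅x, y⁆ * (y * ⁅x, z⁆ * y⁻¹) := by
    simp only [commutatorElement_def]; group
  rw [h1, ← hc x z y]; group

/-- Central commutators: `⁅x⁻¹, y⁆ = ⁅x, y⁆⁻¹`. -/
theorem baer_comm_inv_left (x y : G) : ⁅x⁻¹, y⁆ = ⁅x, y⁆⁻¹ := by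
  have h := baer_comm_mul_left hc x x⁻¹ y
  rw [mul_inv_cancel, commutatorElement_one_left] at h
  exact eq_inv_of_mul_eq_one_right h.symm

/-- Central commutators: `⁅x, y⁻¹⁆ = ⁅x, y⁆⁻¹`. -/
theorem baer_comm_inv_right (x y : G) : ⁅x, y⁻¹⁆ = ⁅x, y⁆⁻¹ := by
  have h := baer_comm_mul_right hc x y y⁻¹
  rw [mul_inv_cancel, commutatorElement_one_right] at h
  exact eq_inv_of_mul_eq_one_right h.symm

/-- A commutator commutes with everything, hence has trivial commutator with everything. -/
theorem baer_comm_comm (x y z : G) : ⁅⁅x, y⁆, z⁆ = 1 := by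
  rw [commutatorElement_def ⁅x, y⁆ z, hc x y z]; group

/-- Powers of commutators are central. -/
theorem baer_pow_central (x y z : G) (m : ℕ) : ⁅x, y⁆ ^ m * z = z * ⁅x, y⁆ ^ m := by
  induction m with
  | zero => simp
  | succ m ih => rw [pow_succ, mul_assoc, hc, ← mul_assoc, ih, mul_assoc]

/-- Left-multiplying by a central power of a commutator does not change commutators. -/
theorem baer_comm_pow_mul (x y a b : G) (m : ℕ) : ⁅⁅x, y⁆ ^ m * a, b⁆ = ⁅a, b⁆ := by
  rw [baer_comm_mul_left hc]
  suffices h : ⁅⁅x, y⁆ ^ m, b⁆ = 1 by rw [h, one_mul]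
  rw [commutatorElement_def, baer_pow_central hc x y b m]; group

/-- Right factor version: `⁅a, ⁅x,y⁆^m * b⁆ = ⁅a, b⁆`. -/
theorem baer_comm_mul_pow (x y a b : G) (m : ℕ) : ⁅a, ⁅x, y⁆ ^ m * b⁆ = ⁅a, b⁆ := by
  rw [baer_comm_mul_right hc]
  suffices h : ⁅a, ⁅x, y⁆ ^ m⁆ = 1 by rw [h, one_mul]
  rw [commutatorElement_def]
  have := baer_pow_central hc x y a m
  calc a * ⁅x, y⁆ ^ m * a⁻¹ * (⁅x, y⁆ ^ m)⁻¹ = ⁅x, y⁆ ^ m * a * a⁻¹ * (⁅x, y⁆ ^ m)⁻¹ := by rw [this]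
    _ = 1 := by group

/-- Inverse powers of commutators are central too. -/
theorem baer_pow_inv_central (x y z : G) (m : ℕ) : (⁅x, y⁆ ^ m)⁻¹ * z = z * (⁅x, y⁆ ^ m)⁻¹ := by
  have h := baer_pow_central hc x y z⁻¹ m
  have := congrArg (fun t => t⁻¹) h
  simpa [mul_inv_rev] using this.symm

end ClassTwo

/-! ## The Baer product -/

section BaerProduct

variable {G : Type*} [Group G] [Fintype G]

/-- The Baer product `x ⋆ y = x * y * (⁅x,y⁆ ^ ((|G|+1)/2))⁻¹` (for `|G|` odd, `g ^ ((|G|+1)/2)` is the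
square root of `g`). -/
def bmul (x y : G) : G := x * y * (⁅x, y⁆ ^ ((Fintype.card G + 1) / 2))⁻¹

/-- Square roots: `g ^ ((|G|+1)/2) * g ^ ((|G|+1)/2) = g` for `|G|` odd. -/
theorem baer_half_mul_half (hodd : Odd (Fintype.card G)) (g : G) :
    g ^ ((Fintype.card G + 1) / 2) * g ^ ((Fintype.card G + 1) / 2) = g := by
  obtain ⟨k, hk⟩ := hodd
  rw [← pow_add, hk]
  have h2 : (2 * k + 1 + 1) / 2 + (2 * k + 1 + 1) / 2 = (2 * k + 1) + 1 := by omega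
  rw [h2, pow_succ, ← hk, pow_card_eq_one, one_mul]

/-- The Baer product is commutative. -/
theorem bmul_comm (hodd : Odd (Fintype.card G)) (hc : ∀ x y z : G, ⁅x, y⁆ * z = z * ⁅x, y⁆)
    (x y : G) : bmul x y = bmul y x := by
  have hsq := baer_half_mul_half hodd ⁅x, y⁆
  unfold bmul
  set m := (Fintype.card G + 1) / 2
  have hyx : ⁅y, x⁆ = ⁅x, y⁆⁻¹ := (commutatorElement_inv x y).symm
  have key : ⁅x, y⁆ * (⁅x, y⁆ ^ m)⁻¹ = ⁅x, y⁆ ^ m := mul_inv_eq_iff_eq_mul.mpr hsq.symm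
  rw [hyx, inv_pow, inv_inv, baer_mul_eq_comm_mul x y, hc x y (y * x), mul_assoc (y * x), key]

/-- The Baer product is associative. -/
theorem bmul_assoc (hc : ∀ x y z : G, ⁅x, y⁆ * z = z * ⁅x, y⁆) (x y z : G) :
    bmul (bmul x y) z = bmul x (bmul y z) := by
  unfold bmul
  set m := (Fintype.card G + 1) / 2
  have ec := fun a b w => baer_pow_inv_central hc a b w m
  have h1 : ⁅x * y * (⁅x, y⁆ ^ m)⁻¹, z⁆ = ⁅x, z⁆ * ⁅y, z⁆ := by
    rw [← ec x y (x * y)]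
    have hinv : (⁅x, y⁆ ^ m)⁻¹ = ⁅y, x⁆ ^ m := by rw [← inv_pow, commutatorElement_inv]
    rw [hinv, baer_comm_pow_mul hc, baer_comm_mul_left hc]
  have h2 : ⁅x, y * z * (⁅y, z⁆ ^ m)⁻¹⁆ = ⁅x, y⁆ * ⁅x, z⁆ := by
    rw [← ec y z (y * z)]
    have hinv : (⁅y, z⁆ ^ m)⁻¹ = ⁅z, y⁆ ^ m := by rw [← inv_pow, commutatorElement_inv]
    rw [hinv, baer_comm_mul_pow hc, baer_comm_mul_right hc]
  rw [h1, h2]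
  have hxy_xz : Commute ⁅x, z⁆ ⁅y, z⁆ := hc x z ⁅y, z⁆
  have hxy_xz' : Commute ⁅x, y⁆ ⁅x, z⁆ := hc x y ⁅x, z⁆
  rw [hxy_xz.mul_pow, hxy_xz'.mul_pow, mul_inv_rev, mul_inv_rev]
  have A : x * y * (⁅x, y⁆ ^ m)⁻¹ * z = x * y * z * (⁅x, y⁆ ^ m)⁻¹ := by
    rw [mul_assoc (x * y), ec x y z, ← mul_assoc]
  rw [A]
  have B : x * (y * z * (⁅y, z⁆ ^ m)⁻¹) = x * y * z * (⁅y, z⁆ ^ m)⁻¹ := by group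
  rw [B]
  have C1 : (⁅x, y⁆ ^ m)⁻¹ * ((⁅y, z⁆ ^ m)⁻¹ * (⁅x, z⁆ ^ m)⁻¹) =
      (⁅y, z⁆ ^ m)⁻¹ * ((⁅x, z⁆ ^ m)⁻¹ * (⁅x, y⁆ ^ m)⁻¹) := by
    rw [← mul_assoc, ec x y ((⁅y, z⁆ ^ m)⁻¹), mul_assoc, ec x y ((⁅x, z⁆ ^ m)⁻¹)]
  rw [mul_assoc (x * y * z), mul_assoc (x * y * z), C1]

/-- `1 ⋆ x = x`. -/
theorem one_bmul (x : G) : bmul 1 x = x := by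
  simp [bmul, commutatorElement_one_left]

/-- `x⁻¹ ⋆ x = 1`. -/
theorem inv_bmul (x : G) : bmul x⁻¹ x = 1 := by
  have h : ⁅x⁻¹, x⁆ = 1 := by rw [commutatorElement_def]; group
  simp [bmul, h]

/-- Key identity for cosets: `c⁻¹ ⋆ (c * u) = u * ⁅c, u⁆ ^ ((|G|+1)/2)`. -/
theorem inv_bmul_mul (hc : ∀ x y z : G, ⁅x, y⁆ * z = z * ⁅x, y⁆) (c u : G) : bmul c⁻¹ (c * u) = u * ⁅c, u⁆ ^ ((Fintype.card G + 1) / 2) := by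
  unfold bmul
  set m := (Fintype.card G + 1) / 2
  have h1 : ⁅c⁻¹, c * u⁆ = ⁅c, u⁆⁻¹ := by
    rw [baer_comm_mul_right hc, baer_comm_inv_left hc, baer_comm_inv_left hc]
    have : ⁅c, c⁆ = 1 := commutatorElement_self c
    rw [this, inv_one, one_mul]
  rw [h1, inv_pow, inv_inv]
  group


/-- ID1 (twisting is multiplicative): `(a·⁅c,a⁆^m) ⋆ (b·⁅c,b⁆^m) = (a ⋆ b)·⁅c, a ⋆ b⁆^m`. -/
theorem bmul_twist (hc : ∀ x y z : G, ⁅x, y⁆ * z = z * ⁅x, y⁆) (c a b : G) :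
    bmul (a * ⁅c, a⁆ ^ ((Fintype.card G + 1) / 2)) (b * ⁅c, b⁆ ^ ((Fintype.card G + 1) / 2)) =
      bmul a b * ⁅c, bmul a b⁆ ^ ((Fintype.card G + 1) / 2) := by
  unfold bmul
  set m := (Fintype.card G + 1) / 2
  have ec := fun x y w => baer_pow_central hc x y w m
  have eci := fun x y w => baer_pow_inv_central hc x y w m
  -- commutator of the twisted elements
  have h1 : ⁅a * ⁅c, a⁆ ^ m, b * ⁅c, b⁆ ^ m⁆ = ⁅a, b⁆ := by
    rw [← ec c a a, ← ec c b b, baer_comm_pow_mul hc, baer_comm_mul_pow hc]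
  -- commutator with a Baer product
  have h2 : ⁅c, a * b * (⁅a, b⁆ ^ m)⁻¹⁆ = ⁅c, a⁆ * ⁅c, b⁆ := by
    rw [← eci a b (a * b)]
    have hinv : (⁅a, b⁆ ^ m)⁻¹ = ⁅b, a⁆ ^ m := by rw [← inv_pow, commutatorElement_inv]
    rw [hinv, baer_comm_mul_pow hc, baer_comm_mul_right hc]
  rw [h1, h2, Commute.mul_pow (show Commute ⁅c, a⁆ ⁅c, b⁆ from hc c a ⁅c, b⁆)]
  -- move the central factors: a sa b sb (ab)⁻ᵐ = a b (ab)⁻ᵐ sa sb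
  calc a * ⁅c, a⁆ ^ m * (b * ⁅c, b⁆ ^ m) * (⁅a, b⁆ ^ m)⁻¹
      = a * (⁅c, a⁆ ^ m * b) * ⁅c, b⁆ ^ m * (⁅a, b⁆ ^ m)⁻¹ := by simp only [mul_assoc]
    _ = a * (b * ⁅c, a⁆ ^ m) * ⁅c, b⁆ ^ m * (⁅a, b⁆ ^ m)⁻¹ := by rw [ec c a b]
    _ = a * b * (⁅c, a⁆ ^ m * (⁅c, b⁆ ^ m * (⁅a, b⁆ ^ m)⁻¹)) := by simp only [mul_assoc]
    _ = a * b * (⁅c, a⁆ ^ m * ((⁅a, b⁆ ^ m)⁻¹ * ⁅c, b⁆ ^ m)) := by rw [eci a b (⁅c, b⁆ ^ m)]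
    _ = a * b * ((⁅c, a⁆ ^ m * (⁅a, b⁆ ^ m)⁻¹) * ⁅c, b⁆ ^ m) := by simp only [mul_assoc]
    _ = a * b * (((⁅a, b⁆ ^ m)⁻¹ * ⁅c, a⁆ ^ m) * ⁅c, b⁆ ^ m) := by rw [eci a b (⁅c, a⁆ ^ m)]
    _ = a * b * (⁅a, b⁆ ^ m)⁻¹ * (⁅c, a⁆ ^ m * ⁅c, b⁆ ^ m) := by simp only [mul_assoc]

/-- ID2 (twisting commutes with inversion): `(a·⁅c,a⁆^m)⁻¹ = a⁻¹·⁅c,a⁻¹⁆^m`. -/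
theorem inv_twist (hc : ∀ x y z : G, ⁅x, y⁆ * z = z * ⁅x, y⁆) (c a : G) :
    (a * ⁅c, a⁆ ^ ((Fintype.card G + 1) / 2))⁻¹ = a⁻¹ * ⁅c, a⁻¹⁆ ^ ((Fintype.card G + 1) / 2) := by
  rw [mul_inv_rev, baer_comm_inv_right hc, inv_pow, baer_pow_inv_central hc]

/-- Baer cancellation at the level of `G`: `a⁻¹ ⋆ (a ⋆ t) = t`. -/
theorem inv_bmul_bmul (hc : ∀ x y z : G, ⁅x, y⁆ * z = z * ⁅x, y⁆) (a t : G) :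
    bmul a⁻¹ (bmul a t) = t := by
  rw [← bmul_assoc hc, inv_bmul, one_bmul]

end BaerProduct

/-! ## The Baer group on a type synonym -/

/-- Type synonym for `G` carrying the Baer group law. -/
def Baer (G : Type*) : Type _ := G

namespace Baer

variable {G : Type*} [Group G] [Fintype G]

/-- `Baer G` is finite with the same elements. -/
instance instFintype : Fintype (Baer G) := ‹Fintype G›

/-- The Baer multiplication on the synonym. -/
@[reducible] def mulInst : Mul (Baer G) := ⟨fun x y => (bmul (show G from x) (show G from y) : G)⟩

/-- The inversion on the synonym (the original one). -/
@[reducible] def invInst : Inv (Baer G) := ⟨fun x => ((show G from x)⁻¹ : G)⟩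

/-- The unit of the synonym (the original one). -/
@[reducible] def oneInst : One (Baer G) := ⟨(1 : G)⟩

/-- **The Baer group** (Baer 1938): `Baer G` with `x ⋆ y = x y · (⁅x,y⁆^{(|G|+1)/2})⁻¹`, unit `1`,
inverse `x⁻¹`, for central commutators (commutative when moreover `|G|` is odd, `bmul_comm`). -/
@[reducible] def group (hc : ∀ x y z : G, ⁅x, y⁆ * z = z * ⁅x, y⁆) : Group (Baer G) :=
  @Group.ofLeftAxioms (Baer G) mulInst invInst oneInst
    (fun x y z => bmul_assoc hc (show G from x) (show G from y) (show G from z))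
    (fun x => one_bmul (show G from x)) (fun x => inv_bmul (show G from x))

end Baer

/-! ## Transfer: odd-order class-2 COSET gates are abelian COSET gates -/

/-- **Baer trick for COSET gates.** The data of a COSET gate over a finite group `G` of ODD order
with CENTRAL commutators (nilpotency class `≤ 2`) are the data of an ABELIAN COSET gate with the same
size parameter: over the Baer group `(G, ⋆)` every left coset `c · H`, `H ≤ G^r`, is the coset
`c ⋆ H'` of the `⋆`-subgroup `H' = {δ · ⁅c,δ⁆^{(|G|+1)/2} : δ ∈ H}` (coordinatewise). With the landed
Stub 3a (`stub_cosetMeetToJoinAbelian`) such gates are poly-size `{∧,∨,1,0}+PERM` circuits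
(Lichter–Pago 2024, proof of Thm 6.2, is the CSP form of this observation). Registered sub-goal
`isAbelianCosetGate_of_odd_central` of the skeleton (binder form). -/
theorem isAbelianCosetGate_of_odd_central' {s : ℕ} {g : GateFn}
    (hg : g.1 ≤ s ∧ ∃ (G : Type) (_ : Group G) (_ : Fintype G) (nv : ℕ),
      Odd (Fintype.card G) ∧ (∀ x y z : G, ⁅x, y⁆ * z = z * ⁅x, y⁆) ∧ Fintype.card G ≤ s ∧ nv ≤ s ∧
      ∃ (r : Fin g.1 → ℕ) (scope : (j : Fin g.1) → Fin (r j) → Fin nv)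
        (H : (j : Fin g.1) → Subgroup (Fin (r j) → G)) (c : (j : Fin g.1) → Fin (r j) → G),
        (∀ j, Fintype.card G ^ r j ≤ s) ∧
        ∀ v : Fin g.1 → Bool, g.2 v = true ↔
          ¬ ∃ h : Fin nv → G, ∀ j, v j = true → (c j)⁻¹ * (fun i => h (scope j i)) ∈ H j) :
    IsAbelianCosetGate s g := by
  obtain ⟨h1, G, iG, iF, nv, hodd, hc, hG, hnv, r, scope, H, c, hr, hiff⟩ := hg
  letI iB : Group (Baer G) := Baer.group hc
  set m := (Fintype.card G + 1) / 2 with hm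
  -- the twisted subgroups
  let H' : (j : Fin g.1) → Subgroup (Fin (r j) → Baer G) := fun j =>
    { carrier := {f | ∃ δ : Fin (r j) → G, δ ∈ H j ∧ ∀ i, (show G from f i) = δ i * ⁅c j i, δ i⁆ ^ m}
      mul_mem' := by
        rintro f₁ f₂ ⟨δ₁, hδ₁, hf₁⟩ ⟨δ₂, hδ₂, hf₂⟩
        refine ⟨fun i => bmul (δ₁ i) (δ₂ i), ?_, fun i => ?_⟩
        · have hprod : (fun i => bmul (δ₁ i) (δ₂ i)) = δ₁ * δ₂ * (⁅δ₁, δ₂⁆ ^ m)⁻¹ := by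
            funext i
            simp only [bmul, Pi.mul_apply, Pi.inv_apply, Pi.pow_apply, commutatorElement_def]
            rfl
          rw [hprod]
          exact (H j).mul_mem ((H j).mul_mem hδ₁ hδ₂)
            ((H j).inv_mem ((H j).pow_mem ((H j).mul_mem ((H j).mul_mem ((H j).mul_mem hδ₁ hδ₂)
              ((H j).inv_mem hδ₁)) ((H j).inv_mem hδ₂)) m))
        · change bmul (show G from f₁ i) (show G from f₂ i) = _
          rw [hf₁ i, hf₂ i, bmul_twist hc]
      one_mem' := ⟨1, (H j).one_mem, fun i => by
        change (1 : G) = _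
        simp [commutatorElement_one_right]⟩
      inv_mem' := by
        rintro f ⟨δ, hδ, hf⟩
        refine ⟨δ⁻¹, (H j).inv_mem hδ, fun i => ?_⟩
        change (show G from f i)⁻¹ = _
        rw [hf i, inv_twist hc, Pi.inv_apply] }
  refine ⟨h1, Baer G, iB, Baer.instFintype, nv, fun a b => bmul_comm hodd hc _ _, hG, hnv, r, scope,
    H', c, hr, fun v => (hiff v).trans ?_⟩
  -- the two solution sets agree under the identity map `G = Baer G`
  refine not_congr ⟨?_, ?_⟩
  · rintro ⟨h, hh⟩
    refine ⟨h, fun j hj => ⟨(c j)⁻¹ * fun i => h (scope j i), hh j hj, fun i => ?_⟩⟩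
    change bmul ((c j) i)⁻¹ (h (scope j i)) = _
    have := inv_bmul_mul hc (c j i) (((c j)⁻¹ * fun i => h (scope j i)) i)
    simpa [Pi.mul_apply, Pi.inv_apply, mul_inv_cancel_left] using this
  · rintro ⟨h, hh⟩
    refine ⟨h, fun j hj => ?_⟩
    obtain ⟨δ, hδ, hf⟩ := hh j hj
    have key : ((c j)⁻¹ * fun i => (show G from h (scope j i))) = δ := by
      funext i
      have hfi := hf i
      change bmul ((c j) i)⁻¹ (show G from h (scope j i)) = _ at hfi
      -- both sides are `(c j i)⁻¹ ⋆ (c j i * _)`; cancel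
      set y : G := (show G from h (scope j i)) with hy
      have e1 := inv_bmul_mul hc (c j i) ((c j i)⁻¹ * y)
      have e2 := inv_bmul_mul hc (c j i) (δ i)
      rw [mul_inv_cancel_left] at e1
      rw [← e2] at hfi
      -- hfi : bmul (c j i)⁻¹ y = bmul (c j i)⁻¹ (c j i * δ i); cancel the Baer left factor
      have := congrArg (bmul (c j i)⁻¹⁻¹) hfi
      rw [inv_bmul_bmul hc, inv_bmul_bmul hc] at this
      -- this : y = c j i * δ i
      change (c j i)⁻¹ * y = δ i
      rw [this, inv_mul_cancel_left]
    rw [key]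
    exact hδ

/-- **Baer trick for COSET gates** (registered sub-goal `isAbelianCosetGate_of_odd_central`, ∀-form):
a COSET gate over a finite group of odd order with central commutators is an abelian COSET gate with
the same size parameter (hence, by the landed Stub 3a, a poly-size `{∧,∨,1,0}+PERM` circuit). -/
theorem isAbelianCosetGate_of_odd_central : ∀ (s : ℕ) (g : GateFn), (g.1 ≤ s ∧ ∃ (G : Type) (_ : Group G) (_ : Fintype G) (nv : ℕ), Odd (Fintype.card G) ∧ (∀ x y z : G, ⁅x, y⁆ * z = z * ⁅x, y⁆) ∧ Fintype.card G ≤ s ∧ nv ≤ s ∧ ∃ (r : Fin g.1 → ℕ) (scope : (j : Fin g.1) → Fin (r j) → Fin nv) (H : (j : Fin g.1) → Subgroup (Fin (r j) → G)) (c : (j : Fin g.1) → Fin (r j) → G), (∀ j, Fintype.card G ^ r j ≤ s) ∧ ∀ v : Fin g.1 → Bool, g.2 v = true ↔ ¬ ∃ h : Fin nv → G, ∀ j, v j = true → (c j)⁻¹ * (fun i => h (scope j i)) ∈ H j) → IsAbelianCosetGate s g :=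
  fun _ _ hg => isAbelianCosetGate_of_odd_central' hg

end Summit.PneNP.PneNP.Cruxes.Capture.CspSpineMeetToJoin
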